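import Literature.NumberTheory.Automorphic.GLOneArchParameterClauses
import Literature.NumberTheory.Automorphic.KimExteriorSquareGL4ArchimedeanTwist
import Literature.NumberTheory.Automorphic.AutomorphicRepsGL
import Summits.Langlands.Langlands.Theorems.IrreducibilityBySelfDualityRegularTwistCMCompactPlaceIntegrality
import HarnessLib

/-!
# Every automorphic representation of `GL₁(𝔸_K)` has an infinity type (any number field `K`)
(crux `Summit.Langlands.Langlands.Theses.QuadraticWindow.HostInducedRep`, item stmt-Langlands-10902, line
`one-transparent-pane`, stub `exists_hasInfinityType_gl_one` = the rank-one case of the fact-stub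
`stub_factInf`, i.e. of the named fact `AutomorphicRepData.exists_hasInfinityType`, Clozel 1990 §3.3)

Let `π = W / W'` be an automorphic representation datum on `GL₁(𝔸_K)` (Borel–Jacquet). The tree proves
that `W / W'` is a line on which `𝔤𝔩₁(K_∞)` acts through a real linear form `d`
(`AutomorphicRepData.exists_linearMap_lieAction_eq_smul_one_glOne`), that `π` has an archimedean
parameter `χ` (`AutomorphicRepData.exists_hasArchParameter_glOne`) and that its clauses at a complex place
`w` read `χ(σ_w) = {a_w}`, `χ(σ̄_w) = {b_w}` with `a_w, b_w` the `id`- and `conj`-projectors of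
`L_w : a ↦ d(a_w)` (`AutomorphicRepData.archParameter_clauses_glOne`), so that `a_w - b_w = -i L_w(i)`.
Torus integrality of the `(𝔤, K_∞)`-module `W / W'` at `w` (`RegularTwistCM.stub_compactPlaceIntegrality`,
any rank: `exp(2π i E₁₁) = 1` in `U(1) ⊆ K_∞`) gives `L_w(i) ∈ iℤ`, hence the integral pairing
`a_w - b_w ∈ ℤ`; the bookkeeping `exists_hasInfinityType_of_integralPairing` (any rank: paired weights at
`σ_w`, their swaps at `σ̄_w`, diagonal weights at real embeddings) then produces a well-formed infinity type.

Main results: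
* `exists_hasInfinityType_of_integralPairing` — any `n`: an archimedean parameter that pairs integrally at
  every complex place gives an infinity type;
* `exists_hasInfinityType_gl_one` — the stub: every datum on `GL₁(𝔸_K)` has an infinity type.

References: L. Clozel, *Motifs et formes automorphes* (1990), §3.3 [Clozel1990]; K. Buzzard, T. Gee (2014),
§3.1 [BuzzardGee2014]; A. Borel, H. Jacquet, Corvallis (1979), 4.6 [BorelJacquet1979].
-/

-- `Summit.Langlands.Langlands.…` (summit = sub-problem name, D-0017 layout) trips `dupNamespace`.
set_option linter.dupNamespace false

noncomputable section

open scoped Classical Matrix ComplexConjugate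
open NumberField NumberField.InfinitePlace NumberField.mixedEmbedding
open Literature.NumberTheory.Automorphic

namespace Summit.Langlands.Langlands.Theorems.HostInducedRep.OneTransparentPane

/-! ### Bookkeeping: an infinity type from integral pairings at the complex places (any rank) -/

/-- `conj ∘ conj ∘ σ = σ` for a complex embedding `σ`. [folklore] -/
private theorem conjugate_conjugate_eq' {K : Type} [Field K] (σ : K →+* ℂ) :
    ComplexEmbedding.conjugate (ComplexEmbedding.conjugate σ) = σ :=
  ComplexEmbedding.involutive_conjugate K σ

/-- At a complex place `w`, the conjugate of the chosen embedding is a different embedding. [folklore] -/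
private theorem conjugate_embedding_ne_of_isComplex' {K : Type} [Field K] {w : InfinitePlace K}
    (hw : w.IsComplex) : ComplexEmbedding.conjugate w.embedding ≠ w.embedding := fun h =>
  (isComplex_iff.mp hw) (ComplexEmbedding.isReal_iff.mpr h)

/-- Every complex embedding defines a real place, or is one of the two embeddings over a complex
place. [folklore] -/
private theorem isReal_mk_or_exists_isComplex' {K : Type} [Field K] (σ : K →+* ℂ) :
    (InfinitePlace.mk σ).IsReal ∨ ∃ w : {w : InfinitePlace K // w.IsComplex},
      σ = w.1.embedding ∨ σ = ComplexEmbedding.conjugate w.1.embedding := by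
  rcases (InfinitePlace.mk σ).isReal_or_isComplex with h | h
  · exact Or.inl h
  · refine Or.inr ⟨⟨InfinitePlace.mk σ, h⟩, ?_⟩
    rcases mk_eq_iff.mp (mk_embedding (InfinitePlace.mk σ)) with h' | h'
    · exact Or.inl h'.symm
    · exact Or.inr h'.symm

-- adapted from the landed `n = 2` bookkeeping `RegularTwistCM.stub_infinityTypeOfLocalPairing`
/-- **Bookkeeping (Clozel's "type à l'infini", any rank `n`).** If an archimedean parameter `χ` of
`π = W / W'` on `GL_n(𝔸_K)` pairs integrally at every complex place `w` — there is a multiset `P_w` of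
archimedean weights `(a_i, b_i)`, `a_i - b_i ∈ ℤ`, with `{a_i} = χ(σ_w)` and `{b_i} = χ(σ̄_w)` — then
`π` has a well-formed infinity type: `P_w` at `σ_w`, `swap P_w` at `σ̄_w`, and the diagonal weights
`{(a, a) : a ∈ χ σ}` at a real embedding `σ`. [cite: Clozel1990, §3.3] -/
theorem exists_hasInfinityType_of_integralPairing {n : ℕ} {K : Type} [Field K] [NumberField K]
    {hcpt : isCompact_glFiniteIntegralLevel n K}
    (π : AutomorphicRepData (AutomorphyDatum.gl n K hcpt)) (χ : (K →+* ℂ) → Multiset ℂ)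
    (hχ : π.HasArchParameter χ)
    (hpair : ∀ w : {w : InfinitePlace K // w.IsComplex}, ∃ P : Multiset ArchWeight,
      P.map ArchWeight.a = χ w.1.embedding ∧
      P.map ArchWeight.b = χ (ComplexEmbedding.conjugate w.1.embedding)) :
    π.exists_hasInfinityType := by
  classical
  choose P hPa hPb using hpair
  have hPb' : ∀ w, ((P w).map ArchWeight.swap).map ArchWeight.a =
      χ (ComplexEmbedding.conjugate w.1.embedding) := fun w => by
    rw [← hPb w, Multiset.map_map]
    rfl
  -- the diagonal weight `a ↦ (a, a)` (real places)
  let diag : ℂ → ArchWeight := fun x => ⟨x, x, 0, by simp⟩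
  let T : InfinityType K n := fun σ =>
    if hw : (InfinitePlace.mk σ).IsComplex then
      (if σ = (InfinitePlace.mk σ).embedding then P ⟨InfinitePlace.mk σ, hw⟩
        else (P ⟨InfinitePlace.mk σ, hw⟩).map ArchWeight.swap)
    else (χ σ).map diag
  have hTc : ∀ (σ : K →+* ℂ) (w : InfinitePlace K) (hw : w.IsComplex), InfinitePlace.mk σ = w →
      T σ = if σ = w.embedding then P ⟨w, hw⟩ else (P ⟨w, hw⟩).map ArchWeight.swap := by
    rintro σ w hw rfl
    exact dif_pos hw
  have hTr : ∀ σ : K →+* ℂ, (InfinitePlace.mk σ).IsReal → T σ = (χ σ).map diag := fun σ hσ =>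
    dif_neg (not_isComplex_iff_isReal.mpr hσ)
  have hTe : ∀ w : {w : InfinitePlace K // w.IsComplex}, T w.1.embedding = P w := fun w => by
    rw [hTc w.1.embedding w.1 w.2 (mk_embedding w.1), if_pos rfl]
  have hTce : ∀ w : {w : InfinitePlace K // w.IsComplex},
      T (ComplexEmbedding.conjugate w.1.embedding) = (P w).map ArchWeight.swap := fun w => by
    rw [hTc (ComplexEmbedding.conjugate w.1.embedding) w.1 w.2
      (by rw [mk_conjugate_eq, mk_embedding]), if_neg (conjugate_embedding_ne_of_isComplex' w.2)]
  refine ⟨T, ⟨fun σ => ?_, fun σ => ?_⟩, ?_⟩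
  · -- exactly `n` weights at every embedding
    rcases isReal_mk_or_exists_isComplex' σ with h | ⟨w, rfl | rfl⟩
    · rw [hTr σ h, Multiset.card_map]
      exact AutomorphicRepData.card_eq_of_hasArchParameter hχ σ
    · rw [hTe, ← Multiset.card_map ArchWeight.a, hPa]
      exact AutomorphicRepData.card_eq_of_hasArchParameter hχ _
    · rw [hTce, Multiset.card_map, ← Multiset.card_map ArchWeight.a, hPa]
      exact AutomorphicRepData.card_eq_of_hasArchParameter hχ _
  · -- compatibility with complex conjugation
    rcases isReal_mk_or_exists_isComplex' σ with h | ⟨w, rfl | rfl⟩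
    · have hσ : ComplexEmbedding.conjugate σ = σ :=
        ComplexEmbedding.isReal_iff.mp (isReal_mk_iff.mp h)
      rw [hσ, hTr σ h, Multiset.map_map]
      rfl
    · rw [hTce, hTe]
    · rw [conjugate_conjugate_eq', hTe, hTce]
      simp only [Multiset.map_map, Function.comp_def, ArchWeight.swap_swap, Multiset.map_id']
  · -- the `a`-exponents are the archimedean parameter `χ`
    have hfun : (fun σ => (T σ).map ArchWeight.a) = χ := by
      funext σ
      rcases isReal_mk_or_exists_isComplex' σ with h | ⟨w, rfl | rfl⟩
      · rw [hTr σ h, Multiset.map_map]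
        exact Multiset.map_id' _
      · rw [hTe, hPa]
      · rw [hTce, hPb']
    rw [hfun]
    exact hχ

/-! ### Rank one: the integral pairing at a complex place from torus integrality -/

/-- `E₁₁ = 1` in `𝔤𝔩₁`. [folklore] -/
private theorem single_zero_zero_one_eq_one :
    Matrix.single (0 : Fin 1) (0 : Fin 1) (1 : ℂ) = (1 : Matrix (Fin 1) (Fin 1) ℂ) := by
  ext i j
  rw [Subsingleton.elim i 0, Subsingleton.elim j 0]
  simp

/-- There are two real-algebra maps `ℂ → ℂ` (`id` and `conj`). [folklore] -/
private theorem card_algHom_complex : (Fintype.card (ℂ →ₐ[ℝ] ℂ) : ℂ) = 2 := by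
  rw [HCEmb.card_algHom_of_im_I (𝕜 := ℂ) (by simp)]
  norm_num

/-- **The rank-one pairing.** For a real linear `L : ℂ → ℂ` (the form through which `𝔤𝔩₁(ℂ) = ℂ`
acts on the line `W / W'` at a complex place), the `id`- and `conj`-projectors
`a = ½ (L 1 - i L i)`, `b = ½ (L 1 + i L i)` satisfy `a - b = -i L(i)`; so if `L(i) = k i` with
`k ∈ ℤ` (torus integrality) then `a - b = k`. Clozel 1990, §3.3 (`z ↦ z^a z̄^b`, `a - b ∈ ℤ`).
[cite: Clozel1990, §3.3] -/
theorem proj_id_sub_proj_conj_eq_of_apply_I (L : ℂ → ℂ) {k : ℤ} (hk : L Complex.I = k * Complex.I) :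
    HCEmb.proj L (AlgHom.id ℝ ℂ) (1 : ℂ) - HCEmb.proj L (Complex.conjAe : ℂ →ₐ[ℝ] ℂ) (1 : ℂ) = k := by
  rw [HCEmb.proj_def, HCEmb.proj_def, card_algHom_complex]
  simp only [AlgHom.coe_id, id_eq, AlgEquiv.coe_toAlgHom, Complex.conjAe_coe, RCLike.I_to_complex,
    Complex.conj_I, map_neg, neg_neg, smul_eq_mul, mul_one, hk]
  linear_combination (-(k : ℂ)) * Complex.I_sq

set_option maxHeartbeats 400000 in
-- the Borel–Jacquet carriers (`AutomorphyDatum.gl`, `W / W'`, `𝔤𝔩₁(K_∞)`) are large terms (as in the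
-- landed `RegularTwistCM.stub_localPairingTransfer`)
/-- **Every automorphic representation of `GL₁(𝔸_K)` has an infinity type** — the rank-one case, over an
ARBITRARY number field `K`, of the named fact `AutomorphicRepData.exists_hasInfinityType` (Clozel 1990,
§3.3). The line `W / W'` carries the real linear form `d` of `𝔤𝔩₁(K_∞)`
(`exists_linearMap_lieAction_eq_smul_one_glOne`); the archimedean parameter
(`exists_hasArchParameter_glOne`) has clauses `χ(σ_w) = {a_w}`, `χ(σ̄_w) = {b_w}` at a complex place `w`
with `a_w - b_w = -i d(i_w)` (`archParameter_clauses_glOne`); torus integrality of the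
`(𝔤, K_∞)`-module `W / W'` (`RegularTwistCM.stub_compactPlaceIntegrality`: `d(i_w) ∈ iℤ` since
`exp (2π i_w) = 1` in `K_∞`) makes the pairing `(a_w, b_w)` integral, and
`exists_hasInfinityType_of_integralPairing` assembles the well-formed infinity type.
[cite: Clozel1990, §3.3] [cite: BorelJacquet1979, 4.6] -/
theorem exists_hasInfinityType_gl_one : ∀ (K : Type) [Field K] [NumberField K]
    (hK : isCompact_glFiniteIntegralLevel 1 K) (P : AutomorphicRepData (AutomorphyDatum.gl 1 K hK)),
    P.exists_hasInfinityType := by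
  intro K _ _ hK π
  obtain ⟨ρ𝔤, hρ⟩ := π.exists_hasLieAction_gl
  obtain ⟨d, hd⟩ := π.exists_linearMap_lieAction_eq_smul_one_glOne ρ𝔤
  obtain ⟨χ, hχ⟩ := π.exists_hasArchParameter_glOne
  obtain ⟨-, hco⟩ := π.archParameter_clauses_glOne hρ d hd hχ
  haveI : Nontrivial π.Quot := π.nontrivial_quot
  refine exists_hasInfinityType_of_integralPairing π χ hχ fun w => ?_
  -- the real linear form `L_w : a ↦ d(a_w)` of the place `w`
  obtain ⟨L, hL⟩ : ∃ L : ℂ → ℂ, ∀ a : ℂ,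
      L a = d ⟨complexPlaceLie 1 w (a • (1 : Matrix (Fin 1) (Fin 1) ℂ)), trivial⟩ :=
    ⟨_, fun _ => rfl⟩
  have hLfun : (fun a : ℂ => d ⟨complexPlaceLie 1 w (a • (1 : Matrix (Fin 1) (Fin 1) ℂ)), trivial⟩) = L :=
    funext fun a => (hL a).symm
  -- torus integrality: `d(i_w) = L(i) ∈ iℤ`
  obtain ⟨k, hk⟩ : ∃ k : ℤ, L Complex.I = k * Complex.I := by
    obtain ⟨v, hv⟩ := exists_ne (0 : π.Quot)
    refine (RegularTwistCM.stub_compactPlaceIntegrality π hρ w).2 0 (L Complex.I) v hv ?_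
    rw [single_zero_zero_one_eq_one]
    show ρ𝔤 ⟨complexPlaceLie 1 w (Complex.I • (1 : Matrix (Fin 1) (Fin 1) ℂ)), trivial⟩ v = L Complex.I • v
    rw [hd, LinearMap.smul_apply, Module.End.one_apply, hL]
  -- the paired weight `(a_w, b_w)`
  refine ⟨{⟨HCEmb.proj L (AlgHom.id ℝ ℂ) 1, HCEmb.proj L (Complex.conjAe : ℂ →ₐ[ℝ] ℂ) 1, k,
    proj_id_sub_proj_conj_eq_of_apply_I L hk⟩}, ?_, ?_⟩
  · have h := hco w (AlgHom.id ℝ ℂ)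
    rw [algHomId_toRingHom_comp, hLfun] at h
    rw [Multiset.map_singleton, h]
  · have h := hco w (Complex.conjAe : ℂ →ₐ[ℝ] ℂ)
    rw [conjAe_toRingHom_comp, hLfun] at h
    rw [Multiset.map_singleton, h]

end Summit.Langlands.Langlands.Theorems.HostInducedRep.OneTransparentPane

end
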